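import Mathlib
import Summits.NavierStokesRegularity.NavierStokesRegularity.Theorems.TaoLadderRungTwoBreakOneShiftTailEstimates
import Summits.NavierStokesRegularity.NavierStokesRegularity.Theorems.TaoLadderRungTwoBreakOneShiftFixedPointDatum
import HarnessLib

/-!
# The one-shift window system, VI: the six RUN CLAUSES of the certificate side as statements about ALL window
# runs from admissible data (cell harvest/h2-tao-ladder, seat p2; rung1/RUNG1-P2G10-REPORT.md §43;
# support for K1(1) = `NoSurvivingDSSOne`, stmt-NavierStokesRegularity-20205)

MODEL lattice ODEs only (Tao 2016 §4 normal form on Tao's shift set `S`); nothing here is a statement about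
the Navier–Stokes equations; no item is closed; nothing numerical is proved.

Six of the eight quantitative clauses of the certificate side (`hAwin`, `hgl`, `hA1`: hulls of the window run;
`hDedge`, `hZedge`, `hγedge`: Lipschitz moduli of the window run in the point and the two edge inputs) speak
about `fullFamily cert w` for admissible points `w` of trajectory space, i.e. about the certificate's window-run
map `cert.Φ` on decoded data. A validated integrator (and its kernel soundness theorem, e.g. a
`CertificateGlueOn.StepCert` chain or `Literature.Analysis.ODE.…VariationalEnclosure…`) never sees `cert.Φ`:
it proves statements about EVERY family that solves the window equations from the box with admissible edge
inputs. This module is the (elementary) bridge: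

* `IsRunFrom ε₀ α y T S` — `S` is a window run on the flight (`WindowRun shiftSet ε₀ α 0 (W-1) Eb Et τ_hi`)
  that starts at `y` on the window and equals the tails `T` off it; `isRunFrom_fullFamily` — for EVERY window
  certificate `cert` and every admissible `w`, `fullFamily cert w` is a run from the decoded data of `w`;
* decoding facts (`abs_decodeY_sub_le`, `decodeTau_mem_Icc`);
* `awin_of_runs`, `gl_of_runs`, `a1_of_runs` — the three hull clauses from their ALL-RUNS forms;
* `dedge_of_runs`, `zedge_of_runs`, `γedge_of_runs` — the three Lipschitz clauses from ALL-PAIRS-OF-RUNS forms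
  with a distance parameter `d` (`|y − y'|_{i,k} ≤ a_{i,k} d`, `|τ − τ'| ≤ r_τ d`, edge differences `≤ B, E`).

So, together with part V (…OneShiftWindowKrawczyk: `hwinIn`/`hWedge` from (K1)–(K3)), EVERY clause of
`T4W76.ClausesFor` & co. now has a kernel reduction to a statement of the shape a validated C¹ integration
proves; the statements themselves remain the engine's (unaudited) assertions.
-/

noncomputable section

-- the sub-problem namespace repeats the summit name by design (D-0017)
set_option linter.dupNamespace false

namespace Summit.NavierStokesRegularity.NavierStokesRegularity.Theorems

namespace DSSOneShift

open Set Metric Literature.Analysis.FluidPDE Literature.Analysis.FluidPDE.TaoCascade CertificateGlueOn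

variable {m : ℕ}

namespace OneShiftFrame

variable (F : OneShiftFrame m)

/-! ### Runs from admissible data -/

/-- **A window run from the data `(y, T)`**: a `WindowRun` of the frame's window system on the whole flight that
starts at `y` on the window and coincides with the tails `T` off the window. (Predicate; what a validated
integrator's soundness theorem quantifies over.) [cite: Tao2016AveragedNS, §4 Lemma 4.1 (4.8); cell vocabulary, window-truncated with edge inputs, harvest/h2-tao-ladder rung1/KERNEL-STAGE3-PLAN.md §2] -/
def IsRunFrom (ε₀ : ℝ) (α : Fin m → Fin m → Fin m → ℤ × ℤ × ℤ → ℝ) (y : Fin m → ℤ → ℝ)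
    (T : Fin m → ℤ → ℝ → ℝ) (S : Fin m → ℤ → ℝ → ℝ) : Prop :=
  WindowRun shiftSet ε₀ α 0 ((F.W : ℤ) - 1) F.Eb F.Et F.τhi S ∧
    (∀ i k, F.InWindow k → S i k 0 = y i k) ∧ (∀ i k, ¬ F.InWindow k → S i k = T i k)

/-- **For every window certificate, the full family of an admissible point is a run from its decoded data.**
[cite: Tao2016AveragedNS, §4 Lemma 4.1 (4.8); cell vocabulary, harvest/h2-tao-ladder rung1/KERNEL-STAGE3-PLAN.md §2 (Φ_run, Φ_init, Φ_tail)] -/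
theorem isRunFrom_fullFamily {ε₀ : ℝ} {α : Fin m → Fin m → Fin m → ℤ × ℤ × ℤ → ℝ}
    (cert : OneShiftWindowCert F ε₀ α) {w : F.Space} (hw : F.Adm w) :
    F.IsRunFrom ε₀ α (F.decodeY w) (F.decodeTail w) (F.fullFamily cert w) := by
  have hAdm := F.admData_decode hw
  have hS : F.fullFamily cert w = cert.Φ (F.decodeY w) (F.decodeTail w) := by
    unfold fullFamily; rw [F.preclampY_eq_decodeY hw, F.preclampTail_eq_decodeTail_fun hw]
  rw [hS]
  exact ⟨cert.Φ_run _ _ hAdm, cert.Φ_init _ _ hAdm, fun i k hk => cert.Φ_tail _ _ i k hk⟩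

/-! ### Decoding facts -/

/-- Decoded window starts of two points differ by at most `a_{i,k} · dist` on the window. [folklore] -/
theorem abs_decodeY_sub_le (u v : F.Space) (i : Fin m) {k : ℤ} (hk : F.InWindow k) :
    |F.decodeY u i k - F.decodeY v i k| ≤ F.a i k * dist u v := by
  unfold decodeY
  rw [dif_pos hk, dif_pos hk]
  have ha := F.a_pos i k
  rw [show F.yc i k + F.a i k * u.1 i ⟨k.toNat, by have := hk.1; have := hk.2; omega⟩ -
      (F.yc i k + F.a i k * v.1 i ⟨k.toNat, by have := hk.1; have := hk.2; omega⟩) =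
      F.a i k * (u.1 i ⟨k.toNat, by have := hk.1; have := hk.2; omega⟩ -
        v.1 i ⟨k.toNat, by have := hk.1; have := hk.2; omega⟩) by ring, abs_mul, abs_of_pos ha]
  refine mul_le_mul_of_nonneg_left ?_ ha.le
  rw [← Real.dist_eq, Prod.dist_eq]
  exact ((dist_le_pi_dist _ _ _).trans (dist_le_pi_dist _ _ i)).trans (le_max_left _ _)

/-- The decoded flight time of an admissible point lies in `[τc − rτ, τc + rτ]`. [folklore] -/
theorem decodeTau_mem_Icc {u : F.Space} (hu : F.Adm u) : F.decodeTau u ∈ Icc (F.τc - F.rτ) (F.τc + F.rτ) := by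
  have h := hu.2.1; rw [abs_le] at h
  have hr := F.rτ_pos
  unfold decodeTau
  constructor <;> nlinarith

/-- `[τc − rτ, τc + rτ] ⊆ [0, τ_hi]`. [folklore] -/
theorem Icc_tau_subset : Icc (F.τc - F.rτ) (F.τc + F.rτ) ⊆ Icc 0 F.τhi := by
  intro τ hτ
  have := F.τc_gt; have := F.rτ_pos
  exact ⟨by linarith [hτ.1], by unfold τhi; linarith [hτ.2]⟩

/-! ### The three hull clauses from all-runs statements -/

section Hulls

variable {ε₀ : ℝ} {α : Fin m → Fin m → Fin m → ℤ × ℤ × ℤ → ℝ} (cert : OneShiftWindowCert F ε₀ α)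

/-- **`hAwin` from its all-runs form**: if every run from admissible data obeys the window amplitude hulls
`A`, so does the full family of every admissible point. [cite: Tao2016AveragedNS, §4 Lemma 4.1 (4.5); cell vocabulary, harvest/h2-tao-ladder rung1/RUNG1-P2G9-REPORT.md §37 (hAwin)] -/
theorem awin_of_runs {A : ℤ → ℝ}
    (h : ∀ y T S, F.AdmData y T → F.IsRunFrom ε₀ α y T S → ∀ j k', F.InWindow k' →
      ∀ s ∈ Icc 0 F.τhi, |S j k' s| ≤ A k') :
    ∀ w, F.Adm w → ∀ j k', F.InWindow k' → ∀ s ∈ Icc 0 F.τhi, |F.fullFamily cert w j k' s| ≤ A k' :=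
  fun _ hw j k' hk' s hs => h _ _ _ (F.admData_decode hw) (F.isRunFrom_fullFamily cert hw) j k' hk' s hs

/-- **`hgl` from its all-runs form**: the hull of the renormalisation factor at every flight time in
`[τc − rτ, τc + rτ]` along every run gives the clause at the decoded flight time.
[cite: Tao2016AveragedNS, §5.3; cell vocabulary, harvest/h2-tao-ladder rung1/RUNG1-P2G9-REPORT.md §37 (hgl)] -/
theorem gl_of_runs {gLo gHi : ℝ}
    (h : ∀ y T S, F.AdmData y T → F.IsRunFrom ε₀ α y T S → ∀ τ ∈ Icc (F.τc - F.rτ) (F.τc + F.rτ),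
      gLo ≤ gfac (slice S τ) ∧ gfac (slice S τ) ≤ gHi) :
    ∀ w, F.Adm w → gLo ≤ gfac (slice (F.fullFamily cert w) (F.decodeTau w)) ∧
      gfac (slice (F.fullFamily cert w) (F.decodeTau w)) ≤ gHi :=
  fun _ hw => h _ _ _ (F.admData_decode hw) (F.isRunFrom_fullFamily cert hw) _ (F.decodeTau_mem_Icc hw)

/-- **`hA1` from its all-runs form** (wake entry `|g z_{i,0}(τ) − tubeC_{i,-1}| ≤ A₁`).
[cite: Tao2016AveragedNS, §5.3; cell vocabulary, harvest/h2-tao-ladder rung1/RUNG1-P2G9-REPORT.md §37 (hA1)] -/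
theorem a1_of_runs {A₁ : ℝ}
    (h : ∀ y T S, F.AdmData y T → F.IsRunFrom ε₀ α y T S → ∀ τ ∈ Icc (F.τc - F.rτ) (F.τc + F.rτ), ∀ i,
      |gfac (slice S τ) * S i 0 τ - F.tubeC i (-1)| ≤ A₁) :
    ∀ w, F.Adm w → ∀ i, |gfac (slice (F.fullFamily cert w) (F.decodeTau w)) *
      F.fullFamily cert w i 0 (F.decodeTau w) - F.tubeC i (-1)| ≤ A₁ :=
  fun _ hw i => h _ _ _ (F.admData_decode hw) (F.isRunFrom_fullFamily cert hw) _ (F.decodeTau_mem_Icc hw) i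

end Hulls

/-! ### The three Lipschitz clauses from all-pairs-of-runs statements -/

section Lipschitz

variable {ε₀ : ℝ} {α : Fin m → Fin m → Fin m → ℤ × ℤ × ℤ → ℝ} (cert : OneShiftWindowCert F ε₀ α)
  (R : ℤ → ℝ)

/-- The data of a pair of `AdmLip` points at distance `d = dist u v`: admissible, time-Lipschitz tails, window
starts within `a · d`, flight times within `rτ · d`. [folklore] -/
theorem pair_data {u v : F.Space} (hu : F.AdmLip R u) (hv : F.AdmLip R v) :
    F.AdmData (F.decodeY u) (F.decodeTail u) ∧ F.AdmData (F.decodeY v) (F.decodeTail v) ∧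
      (∀ i k, ¬ F.InWindow k → ∀ s ∈ Icc 0 F.τhi, ∀ t ∈ Icc 0 F.τhi,
        |F.decodeTail u i k t - F.decodeTail u i k s| ≤ R k * |t - s|) ∧
      (∀ i k, ¬ F.InWindow k → ∀ s ∈ Icc 0 F.τhi, ∀ t ∈ Icc 0 F.τhi,
        |F.decodeTail v i k t - F.decodeTail v i k s| ≤ R k * |t - s|) ∧
      (∀ i k, F.InWindow k → |F.decodeY u i k - F.decodeY v i k| ≤ F.a i k * dist u v) ∧
      |F.decodeTau u - F.decodeTau v| ≤ F.rτ * dist u v :=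
  ⟨F.admData_decode hu.1, F.admData_decode hv.1, hu.2, hv.2, fun i _ hk => F.abs_decodeY_sub_le u v i hk,
    F.abs_decodeTau_sub_le u v⟩

/-- **`hDedge` from its all-pairs form**: a Lipschitz bound for pairs of runs from admissible time-Lipschitz data
— `|S − S'| ≤ vmax·d + χ_b B + χ_e E` on every window shell along the flight whenever the starts differ by
`≤ a d`, the edge tails by `≤ B, E` — gives the clause with `d = dist u v`.
[cite: Tao2016AveragedNS, §4; cell vocabulary, harvest/h2-tao-ladder rung1/RUNG1-P2G9-REPORT.md §37 (hDedge), rung1/STAGE3-BANACH.md §2] -/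
theorem dedge_of_runs {vmax χb χe : ℤ → ℝ}
    (h : ∀ y T S y' T' S' (d B E : ℝ), F.AdmData y T → F.AdmData y' T' →
      (∀ i k, ¬ F.InWindow k → ∀ s ∈ Icc 0 F.τhi, ∀ t ∈ Icc 0 F.τhi, |T i k t - T i k s| ≤ R k * |t - s|) →
      (∀ i k, ¬ F.InWindow k → ∀ s ∈ Icc 0 F.τhi, ∀ t ∈ Icc 0 F.τhi, |T' i k t - T' i k s| ≤ R k * |t - s|) →
      F.IsRunFrom ε₀ α y T S → F.IsRunFrom ε₀ α y' T' S' →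
      (∀ i k, F.InWindow k → |y i k - y' i k| ≤ F.a i k * d) →
      (∀ i, ∀ t ∈ Icc 0 F.τhi, |T i (-1) t - T' i (-1) t| ≤ B) →
      (∀ i, ∀ t ∈ Icc 0 F.τhi, |T i F.W t - T' i F.W t| ≤ E) →
      ∀ j k', F.InWindow k' → ∀ s ∈ Icc 0 F.τhi, |S j k' s - S' j k' s| ≤ vmax k' * d + χb k' * B + χe k' * E)
    (u v : F.Space) (hu : F.AdmLip R u) (hv : F.AdmLip R v) (j : Fin m) (k' : ℤ) (hk' : F.InWindow k')
    (s : ℝ) (hs : s ∈ Icc 0 F.τhi) (B E : ℝ)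
    (hB : ∀ i, ∀ t ∈ Icc 0 F.τhi, |F.decodeTail u i (-1) t - F.decodeTail v i (-1) t| ≤ B)
    (hE : ∀ i, ∀ t ∈ Icc 0 F.τhi, |F.decodeTail u i F.W t - F.decodeTail v i F.W t| ≤ E) :
    |F.fullFamily cert u j k' s - F.fullFamily cert v j k' s| ≤
      vmax k' * dist u v + χb k' * B + χe k' * E := by
  obtain ⟨hAu, hAv, hLu, hLv, hY, -⟩ := F.pair_data R hu hv
  exact h _ _ _ _ _ _ (dist u v) B E hAu hAv hLu hLv (F.isRunFrom_fullFamily cert hu.1)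
    (F.isRunFrom_fullFamily cert hv.1) hY hB hE j k' hk' s hs

/-- **`hZedge` from its all-pairs form**: the left-behind shell `0` read at two flight times within `rτ d` of
each other. [cite: Tao2016AveragedNS, §4, §5.3; cell vocabulary, harvest/h2-tao-ladder rung1/RUNG1-P2G9-REPORT.md §37 (hZedge)] -/
theorem zedge_of_runs {dz χb χe : ℝ}
    (h : ∀ y T S y' T' S' (d B E : ℝ), F.AdmData y T → F.AdmData y' T' →
      (∀ i k, ¬ F.InWindow k → ∀ s ∈ Icc 0 F.τhi, ∀ t ∈ Icc 0 F.τhi, |T i k t - T i k s| ≤ R k * |t - s|) →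
      (∀ i k, ¬ F.InWindow k → ∀ s ∈ Icc 0 F.τhi, ∀ t ∈ Icc 0 F.τhi, |T' i k t - T' i k s| ≤ R k * |t - s|) →
      F.IsRunFrom ε₀ α y T S → F.IsRunFrom ε₀ α y' T' S' →
      (∀ i k, F.InWindow k → |y i k - y' i k| ≤ F.a i k * d) →
      (∀ i, ∀ t ∈ Icc 0 F.τhi, |T i (-1) t - T' i (-1) t| ≤ B) →
      (∀ i, ∀ t ∈ Icc 0 F.τhi, |T i F.W t - T' i F.W t| ≤ E) →
      ∀ τ ∈ Icc (F.τc - F.rτ) (F.τc + F.rτ), ∀ τ' ∈ Icc (F.τc - F.rτ) (F.τc + F.rτ), |τ - τ'| ≤ F.rτ * d →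
      ∀ i, |S i 0 τ - S' i 0 τ'| ≤ dz * d + χb * B + χe * E)
    (u v : F.Space) (hu : F.AdmLip R u) (hv : F.AdmLip R v) (i : Fin m) (B E : ℝ)
    (hB : ∀ i, ∀ t ∈ Icc 0 F.τhi, |F.decodeTail u i (-1) t - F.decodeTail v i (-1) t| ≤ B)
    (hE : ∀ i, ∀ t ∈ Icc 0 F.τhi, |F.decodeTail u i F.W t - F.decodeTail v i F.W t| ≤ E) :
    |F.fullFamily cert u i 0 (F.decodeTau u) - F.fullFamily cert v i 0 (F.decodeTau v)| ≤
      dz * dist u v + χb * B + χe * E := by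
  obtain ⟨hAu, hAv, hLu, hLv, hY, hτ⟩ := F.pair_data R hu hv
  exact h _ _ _ _ _ _ (dist u v) B E hAu hAv hLu hLv (F.isRunFrom_fullFamily cert hu.1)
    (F.isRunFrom_fullFamily cert hv.1) hY hB hE _ (F.decodeTau_mem_Icc hu.1) _ (F.decodeTau_mem_Icc hv.1) hτ i

/-- **`hγedge` from its all-pairs form**: the renormalisation factor `g(z(τ))` read at two flight times within
`rτ d` of each other. [cite: Tao2016AveragedNS, §5.3; cell vocabulary, harvest/h2-tao-ladder rung1/RUNG1-P2G9-REPORT.md §37 (hγedge)] -/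
theorem γedge_of_runs {γx γb γe : ℝ}
    (h : ∀ y T S y' T' S' (d B E : ℝ), F.AdmData y T → F.AdmData y' T' →
      (∀ i k, ¬ F.InWindow k → ∀ s ∈ Icc 0 F.τhi, ∀ t ∈ Icc 0 F.τhi, |T i k t - T i k s| ≤ R k * |t - s|) →
      (∀ i k, ¬ F.InWindow k → ∀ s ∈ Icc 0 F.τhi, ∀ t ∈ Icc 0 F.τhi, |T' i k t - T' i k s| ≤ R k * |t - s|) →
      F.IsRunFrom ε₀ α y T S → F.IsRunFrom ε₀ α y' T' S' →
      (∀ i k, F.InWindow k → |y i k - y' i k| ≤ F.a i k * d) →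
      (∀ i, ∀ t ∈ Icc 0 F.τhi, |T i (-1) t - T' i (-1) t| ≤ B) →
      (∀ i, ∀ t ∈ Icc 0 F.τhi, |T i F.W t - T' i F.W t| ≤ E) →
      ∀ τ ∈ Icc (F.τc - F.rτ) (F.τc + F.rτ), ∀ τ' ∈ Icc (F.τc - F.rτ) (F.τc + F.rτ), |τ - τ'| ≤ F.rτ * d →
      |gfac (slice S τ) - gfac (slice S' τ')| ≤ γx * d + γb * B + γe * E)
    (u v : F.Space) (hu : F.AdmLip R u) (hv : F.AdmLip R v) (B E : ℝ)
    (hB : ∀ i, ∀ t ∈ Icc 0 F.τhi, |F.decodeTail u i (-1) t - F.decodeTail v i (-1) t| ≤ B)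
    (hE : ∀ i, ∀ t ∈ Icc 0 F.τhi, |F.decodeTail u i F.W t - F.decodeTail v i F.W t| ≤ E) :
    |gfac (slice (F.fullFamily cert u) (F.decodeTau u)) - gfac (slice (F.fullFamily cert v) (F.decodeTau v))| ≤
      γx * dist u v + γb * B + γe * E := by
  obtain ⟨hAu, hAv, hLu, hLv, hY, hτ⟩ := F.pair_data R hu hv
  exact h _ _ _ _ _ _ (dist u v) B E hAu hAv hLu hLv (F.isRunFrom_fullFamily cert hu.1)
    (F.isRunFrom_fullFamily cert hv.1) hY hB hE _ (F.decodeTau_mem_Icc hu.1) _ (F.decodeTau_mem_Icc hv.1) hτ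

end Lipschitz

end OneShiftFrame

end DSSOneShift

end Summit.NavierStokesRegularity.NavierStokesRegularity.Theorems
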